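/-
Copyright: cell `pub-balaban-gaps` (G2), seat ne6 (row NE7b), `prover-pub-balaban-gaps-ne6-g13-0`, on leaf-01 g80's `CompactFibreRelative`
(OWNER lineage `t4-ne7b-p1` g106's `CompactFibreCarrier`) and this seat's `CompactFibreWindowSU2` (gen 11). Project licence.
-/
import Summits.QuantumFields.BalabanUV.T4Continuum.Spine.NE7b.CompactFibreRelative
import Summits.QuantumFields.BalabanUV.T4Continuum.Spine.NE7b.CompactFibreWindowSU2

/-!
# THE (n)-CARRIER'S CREATION-STEP PRICE IN THE `SU(2)` MODEL, BY VALUE BUT FOR THREE LETTERS: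
# `∫ F·w·e^{−I} ≤ exp(i₀ − (λ∕2)δ′² + #bonds·(2 log η⁻¹ + log 16))·(∫F dκ)·∫ G·w·e^{−I}` (row NE7b, node U5c; MODEL, [folklore])

Cell `pub-balaban-gaps` (G2 spine census, V25) for the `pub-balaban` T⁴ crux NE7b (`T4WeightBudget.RelWeightBound`; the cell's OWN estimate —
NOT PRINTED in [Bałaban 1983–89], NOT PROVED).  Crux-route MODEL work under `Spine/NE7b/`; NOTHING of Bałaban's is named as a hypothesis
or asserted; no `def`; zero `sorry`.  Imports (oleans present): leaf-01's `…NE7b.CompactFibreRelative` (`relFibre_moment_le_of_centredWindow`: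
the fibrewise-relative compact sandwich on a GROUP fibre with a left-invariant measure) and this seat's `…NE7b.CompactFibreWindowSU2`
(`neg_log_pi_traceWindow_le`: `−log Haar^{⊗bonds}(Π_b W_η) ≤ #bonds·(2 log η⁻¹ + log 16)`, from the tree's
`QuantumLattice.le_haarProbability_su2_two_sub_trace_le`).

WHAT.  The near fibre is the compact group `K = (bonds → SU(2))` with the product Haar probability `κ` (left-invariant: Mathlib's
`Measure.pi` instance), the far space `(Y, μ)` any s-finite measure space; the denominator's window is the product TRACE window
`W_η = Π_b {2 − Re tr V_b ≤ η}` (`= Π_b {‖su2Quat V_b − 1‖ ≤ √η}`, `CompactFibreWindowSU2.traceWindow_eq_quatBall`) about a fibrewise centre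
`U₀ : Y → K`; the numerator is supported where SOME bond sits at quaternion distance `≥ δ′` from the centre
(`‖su2Quat((U₀ y b)⁻¹·x b) − 1‖ ≥ δ′` — the event `1 − χ′` of [Balaban1989LargeFieldI] (1.82) in the `SU(2)` reading), and the action
has a displayed bond-quadratic convexity floor of modulus `λ` on that event, measured from the same base level `m₀ y` as the window's
excess `i₀`.  THEN (**`creationPrice_SU2`**):
`∫ F·w·e^{−I} d(κ⊗μ) ≤ exp(i₀ − (λ∕2)δ′² + #bonds·(2 log η⁻¹ + log 16))·(∫F dκ)·∫ G·w·e^{−I} d(κ⊗μ)` —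
every letter of the (n)-carrier BY VALUE except the three (A3) letters `λ` (print: `γ₀W⁻¹` of [Balaban1989LargeFieldII] (1.77)∕(1.78),
`γ₀` = GAPS G-B9-09), `i₀` (this seat's `CompactFibreWindowCentred.abs_excess_le_of_centredWindow`: `(β∕2)(4ρ)(2s + 4ρ)` per plaquette —
not imported here, that module's olean being unbuilt at write time) and the identification of `F, G, w, I, U₀` with Bałaban's step.
Also: `inv_le_exp_of_neg_log_le` (`−log κ(W) ≤ b ⊢ κ(W)⁻¹ ≤ e^b`), `price_with_volume_le` (the volume letter folded into the exponent),
`creationPrice_SU2_factor_le_exp_neg` (with `∫F dκ ≤ 1`: the step sells `e^{−P}` as soon as `P + i₀ + #bonds·(2 log η⁻¹ + log 16) ≤ (λ∕2)δ′²`);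
**`creationPrice_SU2_profile`** — print's own shape ([Balaban1989LargeFieldII] (1.2)): the denominator's Gaussian INTEGRATED as a profile `q` on the window,
price `e^{−(λ∕2)δ′²}·(∫F dκ ∕ ∫_W e^{−q} dκ)`, no `i₀` (leaf-01's `relFibre_moment_le_of_centredProfile` BY NAME);
§3: the two largeness rows — `NestedWindows`' collar row `log(4·O(1)B₃B₅M⁵) < 4δM` (with `Mc = M` located on [B15] p. 179) and this ledger — are of
the usual «`M` large ∕ `g_k` small» kind: `eventually_collar_row`, `eventually_ledger_row` (k-uniform).

HONEST REMARKS.  MODEL only (SU(2), product Haar, trace windows).  Nothing of Bałaban's asserted; which `η(g_k)`, `δ′_k = g_kA₁p₁(g_k)`,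
`λ`, `i₀` print's step carries and that its carrier IS this one are (A3) ∕ (A1c), NC-NE7b-α UNRULED.  BY-NAME EFFECT ON THE WALL: NONE.
NE7b NOT PRINTED ∕ NOT PROVED; spine PROVED 0∕9; rung (B)+1 on ONE finite T⁴ — NOT infinite volume, NOT the mass gap, NOT Clay.
HONEST DEPENDENCY: continuum YM on T⁴ ⇐ BetaPertH ∧ nine spine estimates (0/9 proved); BetaPertH ⇐ (D1) ∧ (D4) ∧ CAP+tail;
G-an2-4 gates asym, D1 and NE2/3/4.  This file changes none of it.
-/

set_option autoImplicit false

noncomputable section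

open MeasureTheory Real Finset
open Literature.MathematicalPhysics.QuantumFieldTheory (haarProbability)
open Literature.MathematicalPhysics.QuantumLattice (su2Quat)
open Summit.QuantumFields.BalabanUV.T4Continuum.NE7b.CompactFibreRelative (relFibre_moment_le_of_centredWindow
  relFibre_moment_le_of_centredProfile)
open Summit.QuantumFields.BalabanUV.T4Continuum.NE7b.CompactFibreWindowSU2 (measurableSet_traceWindow pi_traceWindow_toReal_pos
  neg_log_pi_traceWindow_le)

namespace Summit.QuantumFields.BalabanUV.T4Continuum.NE7b.CompactFibreCreationFloorSU2

/-! ## §1 Two pieces of arithmetic: the volume letter in the exponent -/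

/-- `−log m ≤ b` for a positive mass `m` gives `m⁻¹ ≤ e^b`. [folklore] -/
theorem inv_le_exp_of_neg_log_le {m b : ℝ} (hm : 0 < m) (h : -Real.log m ≤ b) : m⁻¹ ≤ exp b := by
  rw [← Real.exp_log hm, ← Real.exp_neg]
  exact Real.exp_le_exp.2 h

/-- Folding the volume letter into the exponent: `e^{c}·(A ∕ m) ≤ e^{c + b}·A` for `A ≥ 0`, `0 < m`, `−log m ≤ b`. [folklore] -/
theorem price_with_volume_le {c A m b : ℝ} (hA : 0 ≤ A) (hm : 0 < m) (h : -Real.log m ≤ b) :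
    exp c * (A / m) ≤ exp (c + b) * A := by
  rw [div_eq_mul_inv, Real.exp_add]
  have := inv_le_exp_of_neg_log_le hm h
  have hc : 0 ≤ exp c := (exp_pos c).le
  calc exp c * (A * m⁻¹) = exp c * A * m⁻¹ := by ring
    _ ≤ exp c * A * exp b := mul_le_mul_of_nonneg_left this (mul_nonneg hc hA)
    _ = exp c * exp b * A := by ring

/-! ## §2 The creation-step price on the `SU(2)` product fibre -/

section SU2

variable {B : Type*} [Fintype B] {Y : Type*} [MeasurableSpace Y] (μ : Measure Y) [SFinite μ]

/-- **THE (n)-CARRIER'S CREATION-STEP PRICE, `SU(2)` MODEL.**  Near fibre `bonds → SU(2)` with the product Haar probability, far space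
`(Y, μ)`; numerator factor `F ≥ 0` (integrable), denominator factor `G ≥ 0`, far weight `w ≥ 0`, interaction `I`, fibrewise centre `U₀`,
trace-window half-width `η ∈ (0, ¼]`; per live fibre (`w y ≠ 0`): the denominator factor dominates the centred product window (`hGwin`),
the interaction's excess over a base level `m₀ y` is `≤ i₀` there (`hIrel`), the numerator lives where SOME bond is at quaternion distance
`≥ δ′ ≥ 0` from the centre (`hF`), and a bond-quadratic convexity floor of modulus `λ ≥ 0` from the same base level holds there (`hconv`).
Then `∫ F·w·e^{−I} ≤ exp(i₀ − (λ∕2)δ′² + #bonds·(2 log η⁻¹ + log 16))·(∫F dκ)·∫ G·w·e^{−I}`. [folklore] -/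
theorem creationPrice_SU2 {η : ℝ} (hη0 : 0 < η) (hη : η ≤ 1 / 4)
    (F G : (B → Matrix.specialUnitaryGroup (Fin 2) ℂ) → ℝ) (w : Y → ℝ)
    (I : (B → Matrix.specialUnitaryGroup (Fin 2) ℂ) × Y → ℝ) (m₀ : Y → ℝ) (U₀ : Y → (B → Matrix.specialUnitaryGroup (Fin 2) ℂ))
    {i₀ lam δ' : ℝ} (hF0 : ∀ x, 0 ≤ F x) (hG0 : ∀ x, 0 ≤ G x) (hw0 : ∀ y, 0 ≤ w y) (hlam : 0 ≤ lam) (hδ : 0 ≤ δ')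
    (hF : ∀ x y, F x ≠ 0 → w y ≠ 0 → ∃ b : B, δ' ≤ ‖su2Quat ((U₀ y b)⁻¹ * x b) - 1‖)
    (hconv : ∀ x y, F x ≠ 0 → w y ≠ 0 → m₀ y + lam / 2 * ∑ b, ‖su2Quat ((U₀ y b)⁻¹ * x b) - 1‖ ^ 2 ≤ I (x, y))
    (hGwin : ∀ y v, w y ≠ 0 →
      v ∈ (Set.univ.pi fun _ : B => {U : Matrix.specialUnitaryGroup (Fin 2) ℂ | 2 - ((U : Matrix (Fin 2) (Fin 2) ℂ).trace).re ≤ η}) →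
      1 ≤ G (U₀ y * v))
    (hIrel : ∀ y v, w y ≠ 0 →
      v ∈ (Set.univ.pi fun _ : B => {U : Matrix.specialUnitaryGroup (Fin 2) ℂ | 2 - ((U : Matrix (Fin 2) (Fin 2) ℂ).trace).re ≤ η}) →
      I (U₀ y * v, y) ≤ m₀ y + i₀)
    (hFi : Integrable F (Measure.pi fun _ : B => haarProbability (Matrix.specialUnitaryGroup (Fin 2) ℂ)))
    (hGI : ∀ y, w y ≠ 0 →
      Integrable (fun x => G x * exp (-I (x, y))) (Measure.pi fun _ : B => haarProbability (Matrix.specialUnitaryGroup (Fin 2) ℂ)))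
    (hA' : Integrable (fun z : (B → Matrix.specialUnitaryGroup (Fin 2) ℂ) × Y => F z.1 * w z.2 * exp (-I z))
      ((Measure.pi fun _ : B => haarProbability (Matrix.specialUnitaryGroup (Fin 2) ℂ)).prod μ))
    (hB' : Integrable (fun z : (B → Matrix.specialUnitaryGroup (Fin 2) ℂ) × Y => G z.1 * w z.2 * exp (-I z))
      ((Measure.pi fun _ : B => haarProbability (Matrix.specialUnitaryGroup (Fin 2) ℂ)).prod μ)) :
    ∫ z, F z.1 * w z.2 * exp (-I z) ∂((Measure.pi fun _ : B => haarProbability (Matrix.specialUnitaryGroup (Fin 2) ℂ)).prod μ) ≤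
      exp (i₀ - lam / 2 * δ' ^ 2 + (Fintype.card B : ℝ) * (2 * Real.log η⁻¹ + Real.log 16)) *
        (∫ x, F x ∂(Measure.pi fun _ : B => haarProbability (Matrix.specialUnitaryGroup (Fin 2) ℂ))) *
        ∫ z, G z.1 * w z.2 * exp (-I z) ∂((Measure.pi fun _ : B => haarProbability (Matrix.specialUnitaryGroup (Fin 2) ℂ)).prod μ) := by
  set κ : Measure (B → Matrix.specialUnitaryGroup (Fin 2) ℂ) := Measure.pi fun _ : B => haarProbability (Matrix.specialUnitaryGroup (Fin 2) ℂ)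
    with hκ
  set W : Set (B → Matrix.specialUnitaryGroup (Fin 2) ℂ) :=
    Set.univ.pi fun _ : B => {U : Matrix.specialUnitaryGroup (Fin 2) ℂ | 2 - ((U : Matrix (Fin 2) (Fin 2) ℂ).trace).re ≤ η} with hW
  have hWm : MeasurableSet W := MeasurableSet.univ_pi fun _ => measurableSet_traceWindow η
  have hWpos : 0 < κ.real W := by
    rw [measureReal_def]; exact pi_traceWindow_toReal_pos hη0 hη
  have hvol : -Real.log (κ.real W) ≤ (Fintype.card B : ℝ) * (2 * Real.log η⁻¹ + Real.log 16) := by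
    rw [measureReal_def]; exact neg_log_pi_traceWindow_le hη0 hη
  -- the floor rides in the level: `m y := m₀ y + (λ∕2)δ′²`, excess `i₀ − (λ∕2)δ′²`
  have hnum : ∀ x y, F x ≠ 0 → w y ≠ 0 → m₀ y + lam / 2 * δ' ^ 2 ≤ I (x, y) := by
    intro x y hx hy
    obtain ⟨b, hb⟩ := hF x y hx hy
    have hsq : δ' ^ 2 ≤ ∑ b, ‖su2Quat ((U₀ y b)⁻¹ * x b) - 1‖ ^ 2 :=
      (pow_le_pow_left₀ hδ hb 2).trans
        (Finset.single_le_sum (f := fun b => ‖su2Quat ((U₀ y b)⁻¹ * x b) - 1‖ ^ 2) (fun b _ => sq_nonneg _)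
          (Finset.mem_univ b))
    have := mul_le_mul_of_nonneg_left hsq (by positivity : 0 ≤ lam / 2)
    linarith [hconv x y hx hy]
  have hIrel' : ∀ y v, w y ≠ 0 → v ∈ W → I (U₀ y * v, y) ≤ (m₀ y + lam / 2 * δ' ^ 2) + (i₀ - lam / 2 * δ' ^ 2) := by
    intro y v hy hv
    have := hIrel y v hy hv
    linarith
  have key := relFibre_moment_le_of_centredWindow κ μ F G w I (fun y => m₀ y + lam / 2 * δ' ^ 2) U₀ W hF0 hG0 hw0 hWm hWpos
    hnum hGwin hIrel' hFi hGI hA' hB'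
  have hint : 0 ≤ ∫ z, G z.1 * w z.2 * exp (-I z) ∂(κ.prod μ) :=
    integral_nonneg fun z => mul_nonneg (mul_nonneg (hG0 _) (hw0 _)) (exp_pos _).le
  have hFint : 0 ≤ ∫ x, F x ∂κ := integral_nonneg hF0
  have hstep := price_with_volume_le (c := i₀ - lam / 2 * δ' ^ 2) hFint hWpos hvol
  exact key.trans (mul_le_mul_of_nonneg_right hstep hint)

/-- **WHEN THE STEP SELLS `e^{−P}`** (`SU(2)` model): with `∫F dκ ≤ 1` (e.g. `F` an indicator) the factor in `creationPrice_SU2` is at most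
`e^{−P}` as soon as `P + i₀ + #bonds·(2 log η⁻¹ + log 16) ≤ (λ∕2)δ′²` — the ledger inequality the (A3) instance must meet. [folklore] -/
theorem creationPrice_SU2_factor_le_exp_neg {η i₀ lam δ' A P : ℝ} {n : ℕ} (hA1 : A ≤ 1)
    (hledger : P + i₀ + (n : ℝ) * (2 * Real.log η⁻¹ + Real.log 16) ≤ lam / 2 * δ' ^ 2) :
    exp (i₀ - lam / 2 * δ' ^ 2 + (n : ℝ) * (2 * Real.log η⁻¹ + Real.log 16)) * A ≤ exp (-P) := by
  calc exp (i₀ - lam / 2 * δ' ^ 2 + (n : ℝ) * (2 * Real.log η⁻¹ + Real.log 16)) * A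
      ≤ exp (i₀ - lam / 2 * δ' ^ 2 + (n : ℝ) * (2 * Real.log η⁻¹ + Real.log 16)) * 1 :=
        mul_le_mul_of_nonneg_left hA1 (exp_pos _).le
    _ ≤ exp (-P) := by rw [mul_one]; exact Real.exp_le_exp.2 (by linarith)

/-- **THE SAME PRICE IN PRINT'S PROFILE SHAPE** ([Balaban1989LargeFieldII] p. 356 (1.2): the denominator is expanded about `U₀` and its
Gaussian is INTEGRATED — «`(−½d(𝔤)log g_k⁻² + log σ₀)|Λ^{(k)}∖G₀|`» — rather than bounded by a sup on the window).  With leaf-01's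
`relFibre_moment_le_of_centredProfile`: if on the centred product trace window the interaction exceeds the base level by at most a PROFILE
`q` of the relative position (`hIprof : I (U₀ y · v, y) ≤ m₀ y + q v`, `∫_W e^{−q} dκ > 0`), and the numerator carries the window-complement floor as
in `creationPrice_SU2`, then `∫ F·w·e^{−I} ≤ e^{−(λ∕2)δ′²}·(∫F dκ ∕ ∫_W e^{−q} dκ)·∫ G·w·e^{−I}` — the large-field factor times the volume RATIO, no `i₀`
(the profile `q − (λ∕2)δ′²` against the level `m₀ + (λ∕2)δ′²` is the whole trick). [folklore] -/
theorem creationPrice_SU2_profile {η : ℝ}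
    (F G : (B → Matrix.specialUnitaryGroup (Fin 2) ℂ) → ℝ) (w : Y → ℝ)
    (I : (B → Matrix.specialUnitaryGroup (Fin 2) ℂ) × Y → ℝ) (m₀ : Y → ℝ) (U₀ : Y → (B → Matrix.specialUnitaryGroup (Fin 2) ℂ))
    (q : (B → Matrix.specialUnitaryGroup (Fin 2) ℂ) → ℝ) {lam δ' : ℝ}
    (hF0 : ∀ x, 0 ≤ F x) (hG0 : ∀ x, 0 ≤ G x) (hw0 : ∀ y, 0 ≤ w y) (hlam : 0 ≤ lam) (hδ : 0 ≤ δ')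
    (hqpos : 0 < ∫ v in (Set.univ.pi fun _ : B => {U : Matrix.specialUnitaryGroup (Fin 2) ℂ | 2 - ((U : Matrix (Fin 2) (Fin 2) ℂ).trace).re ≤ η}),
      exp (-q v) ∂(Measure.pi fun _ : B => haarProbability (Matrix.specialUnitaryGroup (Fin 2) ℂ)))
    (hF : ∀ x y, F x ≠ 0 → w y ≠ 0 → ∃ b : B, δ' ≤ ‖su2Quat ((U₀ y b)⁻¹ * x b) - 1‖)
    (hconv : ∀ x y, F x ≠ 0 → w y ≠ 0 → m₀ y + lam / 2 * ∑ b, ‖su2Quat ((U₀ y b)⁻¹ * x b) - 1‖ ^ 2 ≤ I (x, y))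
    (hGwin : ∀ y v, w y ≠ 0 →
      v ∈ (Set.univ.pi fun _ : B => {U : Matrix.specialUnitaryGroup (Fin 2) ℂ | 2 - ((U : Matrix (Fin 2) (Fin 2) ℂ).trace).re ≤ η}) →
      1 ≤ G (U₀ y * v))
    (hIprof : ∀ y v, w y ≠ 0 →
      v ∈ (Set.univ.pi fun _ : B => {U : Matrix.specialUnitaryGroup (Fin 2) ℂ | 2 - ((U : Matrix (Fin 2) (Fin 2) ℂ).trace).re ≤ η}) →
      I (U₀ y * v, y) ≤ m₀ y + q v)
    (hFi : Integrable F (Measure.pi fun _ : B => haarProbability (Matrix.specialUnitaryGroup (Fin 2) ℂ)))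
    (hGI : ∀ y, w y ≠ 0 →
      Integrable (fun x => G x * exp (-I (x, y))) (Measure.pi fun _ : B => haarProbability (Matrix.specialUnitaryGroup (Fin 2) ℂ)))
    (hA' : Integrable (fun z : (B → Matrix.specialUnitaryGroup (Fin 2) ℂ) × Y => F z.1 * w z.2 * exp (-I z))
      ((Measure.pi fun _ : B => haarProbability (Matrix.specialUnitaryGroup (Fin 2) ℂ)).prod μ))
    (hB' : Integrable (fun z : (B → Matrix.specialUnitaryGroup (Fin 2) ℂ) × Y => G z.1 * w z.2 * exp (-I z))
      ((Measure.pi fun _ : B => haarProbability (Matrix.specialUnitaryGroup (Fin 2) ℂ)).prod μ)) :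
    ∫ z, F z.1 * w z.2 * exp (-I z) ∂((Measure.pi fun _ : B => haarProbability (Matrix.specialUnitaryGroup (Fin 2) ℂ)).prod μ) ≤
      (exp (-(lam / 2 * δ' ^ 2)) *
        ((∫ x, F x ∂(Measure.pi fun _ : B => haarProbability (Matrix.specialUnitaryGroup (Fin 2) ℂ))) /
          ∫ v in (Set.univ.pi fun _ : B => {U : Matrix.specialUnitaryGroup (Fin 2) ℂ | 2 - ((U : Matrix (Fin 2) (Fin 2) ℂ).trace).re ≤ η}),
            exp (-q v) ∂(Measure.pi fun _ : B => haarProbability (Matrix.specialUnitaryGroup (Fin 2) ℂ)))) *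
        ∫ z, G z.1 * w z.2 * exp (-I z) ∂((Measure.pi fun _ : B => haarProbability (Matrix.specialUnitaryGroup (Fin 2) ℂ)).prod μ) := by
  set κ : Measure (B → Matrix.specialUnitaryGroup (Fin 2) ℂ) := Measure.pi fun _ : B => haarProbability (Matrix.specialUnitaryGroup (Fin 2) ℂ)
    with hκ
  set W : Set (B → Matrix.specialUnitaryGroup (Fin 2) ℂ) :=
    Set.univ.pi fun _ : B => {U : Matrix.specialUnitaryGroup (Fin 2) ℂ | 2 - ((U : Matrix (Fin 2) (Fin 2) ℂ).trace).re ≤ η} with hW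
  set a : ℝ := lam / 2 * δ' ^ 2 with ha
  have hWm : MeasurableSet W := MeasurableSet.univ_pi fun _ => measurableSet_traceWindow η
  -- the shifted profile integrates to `e^{a}` times the profile's mass
  have hsplit : ∫ v in W, exp (-(q v - a)) ∂κ = exp a * ∫ v in W, exp (-q v) ∂κ := by
    rw [← integral_const_mul]
    refine integral_congr_ae (ae_of_all _ fun v => ?_)
    show exp (-(q v - a)) = exp a * exp (-q v)
    rw [← Real.exp_add]; ring_nf
  have hqpos' : 0 < ∫ v in W, exp (-(q v - a)) ∂κ := by rw [hsplit]; positivity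
  have hnum : ∀ x y, F x ≠ 0 → w y ≠ 0 → m₀ y + a ≤ I (x, y) := by
    intro x y hx hy
    obtain ⟨b, hb⟩ := hF x y hx hy
    have hsq : δ' ^ 2 ≤ ∑ b, ‖su2Quat ((U₀ y b)⁻¹ * x b) - 1‖ ^ 2 :=
      (pow_le_pow_left₀ hδ hb 2).trans
        (Finset.single_le_sum (f := fun b => ‖su2Quat ((U₀ y b)⁻¹ * x b) - 1‖ ^ 2) (fun b _ => sq_nonneg _)
          (Finset.mem_univ b))
    have := mul_le_mul_of_nonneg_left hsq (by positivity : 0 ≤ lam / 2)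
    rw [ha]; linarith [hconv x y hx hy]
  have hIprof' : ∀ y v, w y ≠ 0 → v ∈ W → I (U₀ y * v, y) ≤ (m₀ y + a) + (q v - a) := by
    intro y v hy hv
    have := hIprof y v hy hv
    linarith
  have key := relFibre_moment_le_of_centredProfile κ μ F G w I (fun y => m₀ y + a) U₀ W (fun v => q v - a) hF0 hG0 hw0 hWm hqpos'
    hnum hGwin hIprof' hFi hGI hA' hB'
  rw [hsplit] at key
  have hrew : (∫ x, F x ∂κ) / (exp a * ∫ v in W, exp (-q v) ∂κ) = exp (-a) * ((∫ x, F x ∂κ) / ∫ v in W, exp (-q v) ∂κ) := by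
    rw [Real.exp_neg, div_mul_eq_div_div, ← inv_mul_eq_div (exp a)]
    ring
  rw [hrew] at key
  exact key

end SU2

/-! ## §3 The two largeness rows are of the usual kind (eventually true, `k`-uniform)

(i) `NestedWindows.tail_lt_quarter_of_collar`'s row `log(4K) < 4δ·Mc` with `Mc = M`: [Balaban1989LargeFieldI] p. 179 «the domains `Ω_j^{∼n}` are
unions of `L^{−(k−j)}MR_j`-cubes of the lattice `T_η`. Take the smallest positive integer `N₀` such, that `L^{−N₀+1}MR_{k−N₀+1} = M`» — so at
`j = k₀ + 1 = k − N₀ + 1` the cubes of (1.73)'s «one layer of `M`-cubes» have side `M` (lattice `T_η`), and the collar `Ω_k → Λ` is `≥ 4M` in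
the units of (1.80)'s `dist`; with `K = O(1)B₃B₅M⁵` the row is `log(4·O(1)B₃B₅) + 5 log M < 4δM`, true for every `M ≥ M₀(δ, O(1)B₃B₅)`
(`eventually_collar_row`).  (ii) `creationPrice_SU2_factor_le_exp_neg`'s ledger `P + i₀ + n·(2 log η⁻¹ + log 16) ≤ (λ∕2)δ′²`: in print's
letters `2 log η⁻¹ ≍ ℓ := log g_k⁻²` while `(λ∕2)δ′² = ½γ₀W⁻¹A₁²p₁(g_k)²` with `p₁(g) = ℓ^{p₁}` — at FIXED `n, P, i₀` a power of `ℓ`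
against a linear function, true for every `ℓ ≥ ℓ₀` (`eventually_ledger_row`, the square as the model power).  CAVEAT (print's regime is NOT
fixed-`n`): `n = #𝔹₀ ∼ d(100MR_k)^d` and `W = 6(d+3)(100M(L+1)N^{β₀}R_j)^{d+2}` themselves grow like powers of `ℓ` (`R_k = ℓ^{r₀}`), and it is
print's exponent condition «`2p₁ − (d + 5)r₀ > p₀`» ([Balaban1989LargeFieldII] p. 383) that keeps the floor ahead of the volume letter —
NOT modelled here.  Which `M`, `ℓ`, `p₁`, `r₀` print fixes is (A3); these two lemmas only certify the «`M` large ∕ `g_k` small» SHAPE of the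
rows. -/

section Rows

open Filter Asymptotics

/-- (i) THE COLLAR ROW IS EVENTUALLY TRUE: for `δ > 0`, `K₀ > 0`: `log(4·K₀·M⁵) < 4δ·M` for all large `M`. [folklore] -/
theorem eventually_collar_row {δ K₀ : ℝ} (hδ : 0 < δ) (hK : 0 < K₀) :
    ∀ᶠ M : ℝ in atTop, Real.log (4 * (K₀ * M ^ 5)) < 4 * δ * M := by
  have h1 : ∀ᶠ M : ℝ in atTop, ‖Real.log M‖ ≤ δ / 5 * ‖M‖ := Real.isLittleO_log_id_atTop.bound (by positivity)
  have h2 : ∀ᶠ M : ℝ in atTop, Real.log (4 * K₀) + 1 ≤ δ * M :=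
    (tendsto_id.const_mul_atTop hδ).eventually_ge_atTop _
  filter_upwards [h1, h2, eventually_gt_atTop (0 : ℝ)] with M hM1 hM2 hM0
  rw [Real.norm_of_nonneg (le_of_lt hM0)] at hM1
  have hlogM : Real.log M ≤ δ / 5 * M := (le_abs_self _).trans ((Real.norm_eq_abs _).symm.le.trans hM1)
  rw [show 4 * (K₀ * M ^ 5) = (4 * K₀) * M ^ 5 by ring, Real.log_mul (by positivity) (by positivity), Real.log_pow]
  push_cast
  nlinarith

/-- (ii) THE LEDGER ROW IS EVENTUALLY TRUE (model power `2` for `p₁(g)² ∕ ℓ`): for `c > 0` and any `P, i₀, n, b`: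
`P + i₀ + n·(ℓ + b) ≤ c·ℓ²` for all large `ℓ`. [folklore] -/
theorem eventually_ledger_row {c P i₀ n b : ℝ} (hc : 0 < c) :
    ∀ᶠ ℓ : ℝ in atTop, P + i₀ + n * (ℓ + b) ≤ c * ℓ ^ 2 := by
  have h1 : ∀ᶠ ℓ : ℝ in atTop, |n| + 1 ≤ c / 2 * ℓ := (tendsto_id.const_mul_atTop (by positivity)).eventually_ge_atTop _
  have h2 : ∀ᶠ ℓ : ℝ in atTop, |P + i₀ + n * b| ≤ c / 2 * ℓ := (tendsto_id.const_mul_atTop (by positivity)).eventually_ge_atTop _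
  filter_upwards [h1, h2, eventually_ge_atTop (1 : ℝ)] with ℓ hℓ1 hℓ2 hℓ0
  have hn : n * ℓ ≤ (c / 2 * ℓ) * ℓ := by
    have : n * ℓ ≤ |n| * ℓ := mul_le_mul_of_nonneg_right (le_abs_self n) (by linarith)
    nlinarith
  have hcl : c / 2 * ℓ ≤ (c / 2 * ℓ) * ℓ := by
    have h0 : 0 ≤ c / 2 * ℓ := by positivity
    nlinarith
  have hP : P + i₀ + n * b ≤ (c / 2 * ℓ) * ℓ := (le_abs_self _).trans (hℓ2.trans hcl)
  have hsplit : P + i₀ + n * (ℓ + b) = (P + i₀ + n * b) + n * ℓ := by ring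
  rw [hsplit]
  nlinarith

end Rows

/-! ## §4 Sanity -/

/-- Toy for §1: mass `m = e^{−2}` (`−log m = 2`), so `m⁻¹ ≤ e²`. -/
example : (exp (-2 : ℝ))⁻¹ ≤ exp 2 := inv_le_exp_of_neg_log_le (exp_pos _) (by rw [Real.log_exp]; norm_num)

end Summit.QuantumFields.BalabanUV.T4Continuum.NE7b.CompactFibreCreationFloorSU2
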